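import Mathlib

/-!
# Crux `HodgeAbelianVarieties` (stmt-HodgeConjecture-1333), line `cm-pivot-andre` — stub `exists_coeff_interpolation` (W6)

Coefficient extraction by rational Lagrange interpolation at the integer nodes `0, 1, …, d`:
there is a rational matrix `V : Fin (d+1) → Fin (d+1) → ℚ` such that for every complex polynomial
`h` of degree `≤ d` and every `k ≤ d`, `coeff_k(h) = Σ_t V k t · h(t)`. Indeed `V k t` is the `k`-th
coefficient of the `t`-th Lagrange basis polynomial for the nodes `0, …, d` (a rational polynomial),
and `h = Σ_t h(t) · L_t` by Lagrange interpolation (`Lagrange.eq_interpolate`); the complex Lagrange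
basis at the nodes `(t : ℂ)` is the base change of the rational one.

In the lead's André construction this makes the elementary-symmetric operators `E_k` on `Hᵈ(B(ℂ); ℂ)`
RATIONAL combinations of the pull-backs `(t • 𝟙 + θ)^*`, `t = 0, …, d`.
-/

set_option linter.dupNamespace false

noncomputable section

namespace Summit.HodgeConjecture.HodgeConjecture.Theorems.HodgeAbelianVarieties.CMPivotAndre

open Polynomial Finset

/-- Base change of a Lagrange basis divisor `C (x - y)⁻¹ * (X - C y)` along a ring homomorphism of
fields. [folklore] -/
theorem map_basisDivisor {F K : Type*} [Field F] [Field K] (φ : F →+* K) (x y : F) :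
    (Lagrange.basisDivisor x y).map φ = Lagrange.basisDivisor (φ x) (φ y) := by
  simp [Lagrange.basisDivisor, Polynomial.map_mul, Polynomial.map_sub, map_inv₀]

/-- Base change of the Lagrange basis polynomials along a ring homomorphism of fields: the Lagrange
basis at the nodes `φ ∘ v` is the image of the Lagrange basis at the nodes `v`. [folklore] -/
theorem map_lagrangeBasis {F K : Type*} [Field F] [Field K] (φ : F →+* K) {ι : Type*}
    [DecidableEq ι] (s : Finset ι) (v : ι → F) (i : ι) :
    (Lagrange.basis s v i).map φ = Lagrange.basis s (fun j => φ (v j)) i := by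
  simp [Lagrange.basis, Polynomial.map_prod, map_basisDivisor]

/-- The coefficients of a polynomial of degree `< #s` over a field are the node values weighted by the
coefficients of the Lagrange basis polynomials: `coeff_k(f) = Σ_{i ∈ s} f(v i) · coeff_k(L_i)`.
[folklore] -/
theorem coeff_eq_sum_eval_mul_coeff_lagrangeBasis {F : Type*} [Field F] {ι : Type*} [DecidableEq ι]
    {s : Finset ι} {v : ι → F} (hvs : Set.InjOn v s) {f : F[X]} (hf : f.degree < #s) (k : ℕ) :
    f.coeff k = ∑ i ∈ s, f.eval (v i) * (Lagrange.basis s v i).coeff k := by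
  conv_lhs => rw [Lagrange.eq_interpolate hvs hf]
  rw [Lagrange.interpolate_apply, Polynomial.finsetSum_coeff]
  simp [Polynomial.coeff_C_mul]

/-- **Stub W6 of line `cm-pivot-andre` — rational coefficient extraction.** For every `d` there is a
rational matrix `V : Fin (d+1) → Fin (d+1) → ℚ` with `Σ_t V k t · h(t) = coeff_k(h)` for every complex
polynomial `h` of degree `≤ d` and every `k ≤ d`: take `V k t := coeff_k` of the `t`-th Lagrange basis
polynomial over `ℚ` for the nodes `0, 1, …, d`; then `h = Σ_t h(t) L_t` (Lagrange interpolation,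
`Lagrange.eq_interpolate`) and the complex Lagrange basis at the nodes `(t : ℂ)` is the base change of
the rational one. [folklore] -/
theorem exists_coeff_interpolation : ∀ d : ℕ, ∃ V : Fin (d + 1) → Fin (d + 1) → ℚ, ∀ (h : Polynomial ℂ), h.natDegree ≤ d → ∀ k : Fin (d + 1), ∑ t : Fin (d + 1), (V k t : ℂ) * h.eval ((t : ℕ) : ℂ) = h.coeff (k : ℕ) := by
  intro d
  refine ⟨fun k t => (Lagrange.basis Finset.univ (fun j : Fin (d + 1) => ((j : ℕ) : ℚ)) t).coeff
    (k : ℕ), fun h hh k => ?_⟩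
  dsimp only
  -- the complex nodes `0, 1, …, d` are pairwise distinct
  have hvs : Set.InjOn (fun t : Fin (d + 1) => ((t : ℕ) : ℂ)) (Finset.univ : Finset (Fin (d + 1))) := by
    intro a _ b _ hab
    have hab' : ((a : ℕ) : ℂ) = ((b : ℕ) : ℂ) := hab
    exact Fin.ext (by exact_mod_cast hab')
  have hdeg : h.degree < #(Finset.univ : Finset (Fin (d + 1))) := by
    rw [Finset.card_univ, Fintype.card_fin]
    exact lt_of_le_of_lt (Polynomial.degree_le_of_natDegree_le hh)
      (by exact_mod_cast Nat.lt_succ_self d)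
  rw [coeff_eq_sum_eval_mul_coeff_lagrangeBasis hvs hdeg (k : ℕ)]
  refine Finset.sum_congr rfl fun t _ => ?_
  -- the complex Lagrange basis at the nodes `(t : ℂ)` is the base change of the rational one
  have hb : (Lagrange.basis Finset.univ (fun j : Fin (d + 1) => ((j : ℕ) : ℚ)) t).map
      (algebraMap ℚ ℂ) = Lagrange.basis Finset.univ (fun j : Fin (d + 1) => ((j : ℕ) : ℂ)) t := by
    rw [map_lagrangeBasis]
    simp only [map_natCast]
  rw [mul_comm, ← hb, Polynomial.coeff_map, eq_ratCast]

end Summit.HodgeConjecture.HodgeConjecture.Theorems.HodgeAbelianVarieties.CMPivotAndre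

end
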